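import Mathlib
import Summits.NavierStokesRegularity.NavierStokesRegularity.Theorems.EulerZoomLiouvillePowerGaugeEulerLiouvilleHoopAxisLawSigma
import Summits.NavierStokesRegularity.NavierStokesRegularity.Theorems.EulerZoomLiouvillePowerGaugeEulerLiouvilleHoopAxisRadialIntegrated
import Summits.NavierStokesRegularity.NavierStokesRegularity.Theorems.EulerZoomLiouvillePowerGaugeEulerLiouvilleHoopAxisEndTerm
import HarnessLib

/-!
# HOOP LINE, K-AXIS plate AX-4 (part 2) — `HoopCore.AxisLawCentre γ`: the integrated general-line axis law
# (route `EulerZoomLiouville`, crux E = stmt-NavierStokesRegularity-19832; class-free identity, `--supports` only)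

`theorem axisLawCentre : HoopCore.AxisLawCentre γ` (HOOP-NOTE §8, typed by LEAD 19832 in `…HoopDefs`): for every profile pair
`IsSelfSimilarEulerProfile γ c V P` with ARBITRARY similarity centre `c`, every radial segment `[s₁, s₂]` of the `x₂`-axis and
every `T₀ > 0`, the axis-minus-circle pressure drop integrates to
`∫∫⟨V_r²−V_θ²⟩dt/t dσ − ½∫‖V_⊥(σe_z)‖² + (1−3γ)∫∫⟨V_r⟩ + ∫⟨(γT₀+V_r)V_r⟩(σ,T₀)dσ + [endTermC]_{s₁}^{s₂} − [offsetTerm]_{s₁}^{s₂}`.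

Assembly (AX-4 of the LEAD's K-AXIS split, key 01:50:27Z / ruling 02:48:12Z): LEAD 19832's fixed-height law `HoopCore.axisLaw_slice`
(`…HoopAxisRadialIntegrated`, AX-2/AX-3 with ns-ezl-w3 g6/g7's frame and atom files) integrated over `σ ∈ [s₁, s₂]` by
`integral_axisLaw_of_fixed` (`…HoopAxisLawSigma`, part 1), and the end density identified with `[endTermC] − [offsetTerm]`:
* `integral_endDensity_eq` — generic: if `∂_σ e = eσ`, `∂_σ o = oσ` with `e, eσ, o, oσ` jointly continuous in `(σ, t)`, then
  `∫_{s₁}^{s₂} ∫₀^{T₀} (eσ − γ·oσ) dt dσ = [∫₀^{T₀} e]_{s₁}^{s₂} − (γ∫₀^{T₀} o(s₂,·) − γ∫₀^{T₀} o(s₁,·))` (differentiation under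
  `∫₀^{T₀} dt`, ns-ezl-w2 g5's `hasDerivAt_intervalIntegral_of_continuous`, then FTC in `σ`);
* the instantiation with the slice forms of the `endTermC` / `offsetTerm` integrands and `axisLawCentre`;
* `axisLawIntegrated : AxisLawIntegrated γ` — the radial-axis form (centre `c = 0`: ns-ezl-w3 g7's `endTermC_zero`, `offsetTerm_zero`);
* `integral_axisHoopTerm_eq_hoopDensity` — glue: the hoop term of (AX∫) equals `(2π)⁻¹ ∫_{solidCyl} hoopDensity V`, the left side
  of `hoopInequality` (p690408).

HONEST FRAME: a class-free identity about hypothetical self-similar profiles (a TOOL of the hoop / axis-law line, to be paired with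
`hoopInequality`); 19832 OPEN; NS regularity NOT proved; not E.  [HOOP-NOTE §2/§8 (ns-idea-11 g8); folklore]
-/

noncomputable section

open MeasureTheory Set WithLp Metric Real Function
open scoped InnerProductSpace RealInnerProductSpace

set_option linter.dupNamespace false

namespace Summit.NavierStokesRegularity.NavierStokesRegularity.Theorems.PowerGaugeEulerLiouville.HoopCore

open Literature.Analysis Literature.Analysis.FluidPDE Condenser

variable {V : EuclideanSpace ℝ (Fin 3) → EuclideanSpace ℝ (Fin 3)}

/-! ## The end density integrates to the end terms -/

/-- **The end density integrates to the end terms** (generic).  If `e, o : ℝ → ℝ → ℝ` (functions of `(σ, t)`) have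
`σ`-derivatives `eσ, oσ` everywhere and `e, eσ, o, oσ` are jointly continuous, then for all `γ s₁ s₂ T₀`,
`∫_{s₁}^{s₂} ∫₀^{T₀} (eσ(σ,t) − γ·oσ(σ,t)) dt dσ = (∫₀^{T₀} e(s₂,·) − ∫₀^{T₀} e(s₁,·)) − (γ∫₀^{T₀} o(s₂,·) − γ∫₀^{T₀} o(s₁,·))`
(the `σ`-primitive `σ ↦ ∫₀^{T₀}(e − γ o)(σ,t) dt` is differentiated under the integral sign and the FTC applied). [folklore] -/
theorem integral_endDensity_eq {e eσ o oσ : ℝ → ℝ → ℝ} (he : ∀ σ t, HasDerivAt (fun σ => e σ t) (eσ σ t) σ)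
    (ho : ∀ σ t, HasDerivAt (fun σ => o σ t) (oσ σ t) σ) (hec : Continuous (uncurry e))
    (heσc : Continuous (uncurry eσ)) (hoc : Continuous (uncurry o)) (hoσc : Continuous (uncurry oσ)) (γ s₁ s₂ T₀ : ℝ) :
    ∫ σ in s₁..s₂, ∫ t in (0 : ℝ)..T₀, (eσ σ t - γ * oσ σ t) =
      ((∫ t in (0 : ℝ)..T₀, e s₂ t) - ∫ t in (0 : ℝ)..T₀, e s₁ t) -
        (γ * (∫ t in (0 : ℝ)..T₀, o s₂ t) - γ * ∫ t in (0 : ℝ)..T₀, o s₁ t) := by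
  -- the `σ`-primitive and its derivative
  have hF : Continuous (uncurry fun σ t => e σ t - γ * o σ t) := hec.sub (continuous_const.mul hoc)
  have hF' : Continuous (uncurry fun σ t => eσ σ t - γ * oσ σ t) := heσc.sub (continuous_const.mul hoσc)
  have hU : ∀ σ, HasDerivAt (fun σ => ∫ t in (0 : ℝ)..T₀, (e σ t - γ * o σ t))
      (∫ t in (0 : ℝ)..T₀, (eσ σ t - γ * oσ σ t)) σ :=
    fun σ => hasDerivAt_intervalIntegral_of_continuous (F := fun σ t => e σ t - γ * o σ t)
      (F' := fun σ t => eσ σ t - γ * oσ σ t) (fun σ t => (he σ t).sub ((ho σ t).const_mul γ)) hF hF' 0 T₀ σ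
  have hU'c : Continuous fun σ => ∫ t in (0 : ℝ)..T₀, (eσ σ t - γ * oσ σ t) :=
    intervalIntegral.continuous_parametric_intervalIntegral_of_continuous' hF' _ _
  rw [intervalIntegral.integral_eq_sub_of_hasDerivAt (fun σ _ => hU σ) (hU'c.intervalIntegrable _ _)]
  -- split the two `t`-integrals at `s₂` and `s₁`
  have hsplit : ∀ s : ℝ, ∫ t in (0 : ℝ)..T₀, (e s t - γ * o s t) =
      (∫ t in (0 : ℝ)..T₀, e s t) - γ * ∫ t in (0 : ℝ)..T₀, o s t := by
    intro s
    have i1 : IntervalIntegrable (fun t => e s t) volume 0 T₀ :=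
      (hec.comp (continuous_const.prodMk continuous_id)).intervalIntegrable _ _
    have i2 : IntervalIntegrable (fun t => γ * o s t) volume 0 T₀ :=
      ((hoc.comp (continuous_const.prodMk continuous_id)).const_mul γ).intervalIntegrable _ _
    rw [intervalIntegral.integral_sub i1 i2, intervalIntegral.integral_const_mul]
  rw [hsplit s₂, hsplit s₁]
  ring

/-! ## `AxisLawCentre γ` -/

/-- **The end density of `axisLaw_slice` integrates to `[endTermC] − [offsetTerm]`** (`V ∈ C¹`; any `γ c s₁ s₂`, `T₀ ≥ 0`):
`∫_{s₁}^{s₂} ∫₀^{T₀} ((2π)⁻¹∫((γ + a_zz)a + (γ(σ−c₂) + V_z)a_zr) − γ(2π)⁻¹∫(−⟪c,R_θe₀⟫)a_zz) dt dσ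
  = (endTermC γ c V T₀ s₂ − endTermC γ c V T₀ s₁) − (offsetTerm γ c V T₀ s₂ − offsetTerm γ c V T₀ s₁)`
(`integral_endDensity_eq` with LEAD 19832's `hasDerivAt_sliceEndFlux_height` / `hasDerivAt_sliceOffsetFlux_height`, and the slice
forms `circleAvg_endFlux_eq_slice` / `circleAvg_offsetFlux_eq_slice` on `t ∈ (0, T₀]`). [folklore] -/
theorem integral_axisEndDensity_eq (hV : ContDiff ℝ 1 V) (γ : ℝ) (c : EuclideanSpace ℝ (Fin 3)) (s₁ s₂ : ℝ) {T₀ : ℝ}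
    (hT₀ : 0 ≤ T₀) :
    ∫ σ in s₁..s₂, ∫ t in (0 : ℝ)..T₀,
        ((1 / (2 * Real.pi)) * (∫ θ in (0 : ℝ)..(2 * Real.pi),
            ((γ + ⟪fderiv ℝ V (axisPt σ t θ) eZ, eZ⟫) *
                ⟪V (axisPt σ t θ), rotZ θ (EuclideanSpace.single (0 : Fin 3) (1 : ℝ))⟫ +
              (γ * (σ - c 2) + axialVelocity V (axisPt σ t θ)) *
                ⟪fderiv ℝ V (axisPt σ t θ) eZ, rotZ θ (EuclideanSpace.single (0 : Fin 3) (1 : ℝ))⟫))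
          - γ * ((1 / (2 * Real.pi)) * ∫ θ in (0 : ℝ)..(2 * Real.pi),
            (-⟪c, rotZ θ (EuclideanSpace.single (0 : Fin 3) (1 : ℝ))⟫) * ⟪fderiv ℝ V (axisPt σ t θ) eZ, eZ⟫)) =
      (endTermC γ c V T₀ s₂ - endTermC γ c V T₀ s₁) - (offsetTerm γ c V T₀ s₂ - offsetTerm γ c V T₀ s₁) := by
  have hVc : Continuous V := hV.continuous
  -- joint continuity of the four slice integrands in `(σ, t, θ)`
  have hA : Continuous fun p : ℝ × ℝ × ℝ =>
      ⟪V (axisPt p.1 p.2.1 p.2.2), rotZ p.2.2 (EuclideanSpace.single (0 : Fin 3) (1 : ℝ))⟫ := continuous_sliceA hVc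
  have hC : Continuous fun p : ℝ × ℝ × ℝ => axialVelocity V (axisPt p.1 p.2.1 p.2.2) := continuous_sliceC hVc
  have hAZZ : Continuous fun p : ℝ × ℝ × ℝ => ⟪fderiv ℝ V (axisPt p.1 p.2.1 p.2.2) eZ, eZ⟫ :=
    continuous_sliceEntry hV continuous_const continuous_const
  have hAZR : Continuous fun p : ℝ × ℝ × ℝ =>
      ⟪fderiv ℝ V (axisPt p.1 p.2.1 p.2.2) eZ, rotZ p.2.2 (EuclideanSpace.single (0 : Fin 3) (1 : ℝ))⟫ :=
    continuous_sliceEntry hV continuous_const continuous_rotZ_single_zero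
  have hCR : Continuous fun p : ℝ × ℝ × ℝ => -⟪c, rotZ p.2.2 (EuclideanSpace.single (0 : Fin 3) (1 : ℝ))⟫ :=
    ((continuous_inner_rotZ_single_zero c).comp (continuous_snd.comp continuous_snd)).neg
  have hσ : Continuous fun p : ℝ × ℝ × ℝ => γ * (p.1 - c 2) := continuous_const.mul (continuous_fst.sub continuous_const)
  have hE : Continuous fun p : ℝ × ℝ × ℝ => (γ * (p.1 - c 2) + axialVelocity V (axisPt p.1 p.2.1 p.2.2)) *
      ⟪V (axisPt p.1 p.2.1 p.2.2), rotZ p.2.2 (EuclideanSpace.single (0 : Fin 3) (1 : ℝ))⟫ := (hσ.add hC).mul hA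
  have hX : Continuous fun p : ℝ × ℝ × ℝ => (γ + ⟪fderiv ℝ V (axisPt p.1 p.2.1 p.2.2) eZ, eZ⟫) *
        ⟪V (axisPt p.1 p.2.1 p.2.2), rotZ p.2.2 (EuclideanSpace.single (0 : Fin 3) (1 : ℝ))⟫ +
      (γ * (p.1 - c 2) + axialVelocity V (axisPt p.1 p.2.1 p.2.2)) *
        ⟪fderiv ℝ V (axisPt p.1 p.2.1 p.2.2) eZ, rotZ p.2.2 (EuclideanSpace.single (0 : Fin 3) (1 : ℝ))⟫ :=
    ((continuous_const.add hAZZ).mul hA).add ((hσ.add hC).mul hAZR)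
  have hO : Continuous fun p : ℝ × ℝ × ℝ => (-⟪c, rotZ p.2.2 (EuclideanSpace.single (0 : Fin 3) (1 : ℝ))⟫) *
      axialVelocity V (axisPt p.1 p.2.1 p.2.2) := hCR.mul hC
  have hY : Continuous fun p : ℝ × ℝ × ℝ => (-⟪c, rotZ p.2.2 (EuclideanSpace.single (0 : Fin 3) (1 : ℝ))⟫) *
      ⟪fderiv ℝ V (axisPt p.1 p.2.1 p.2.2) eZ, eZ⟫ := hCR.mul hAZZ
  -- the `(σ, t)`-functions `e, eσ, o, oσ` are jointly continuous
  have jc : ∀ {F : ℝ × ℝ × ℝ → ℝ}, Continuous F →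
      Continuous (uncurry fun σ t : ℝ => (1 / (2 * Real.pi)) * ∫ θ in (0 : ℝ)..(2 * Real.pi), F (σ, t, θ)) :=
    fun hF => continuous_const.mul
      (intervalIntegral.continuous_parametric_intervalIntegral_of_continuous' (continuous_uncurry_pair hF) _ _)
  have h := integral_endDensity_eq
    (e := fun σ t => (1 / (2 * Real.pi)) * ∫ θ in (0 : ℝ)..(2 * Real.pi),
      (γ * (σ - c 2) + axialVelocity V (axisPt σ t θ)) * ⟪V (axisPt σ t θ), rotZ θ (EuclideanSpace.single (0 : Fin 3) (1 : ℝ))⟫)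
    (eσ := fun σ t => (1 / (2 * Real.pi)) * ∫ θ in (0 : ℝ)..(2 * Real.pi),
      ((γ + ⟪fderiv ℝ V (axisPt σ t θ) eZ, eZ⟫) * ⟪V (axisPt σ t θ), rotZ θ (EuclideanSpace.single (0 : Fin 3) (1 : ℝ))⟫ +
        (γ * (σ - c 2) + axialVelocity V (axisPt σ t θ)) *
          ⟪fderiv ℝ V (axisPt σ t θ) eZ, rotZ θ (EuclideanSpace.single (0 : Fin 3) (1 : ℝ))⟫))
    (o := fun σ t => (1 / (2 * Real.pi)) * ∫ θ in (0 : ℝ)..(2 * Real.pi),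
      (-⟪c, rotZ θ (EuclideanSpace.single (0 : Fin 3) (1 : ℝ))⟫) * axialVelocity V (axisPt σ t θ))
    (oσ := fun σ t => (1 / (2 * Real.pi)) * ∫ θ in (0 : ℝ)..(2 * Real.pi),
      (-⟪c, rotZ θ (EuclideanSpace.single (0 : Fin 3) (1 : ℝ))⟫) * ⟪fderiv ℝ V (axisPt σ t θ) eZ, eZ⟫)
    (fun σ t => (hasDerivAt_sliceEndFlux_height hV γ c σ t).const_mul (1 / (2 * Real.pi)))
    (fun σ t => (hasDerivAt_sliceOffsetFlux_height hV c σ t).const_mul (1 / (2 * Real.pi)))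
    (jc hE) (jc hX) (jc hO) (jc hY) γ s₁ s₂ T₀
  -- recognise `endTermC` and `offsetTerm`
  have hend : ∀ s : ℝ, ∫ t in (0 : ℝ)..T₀, (1 / (2 * Real.pi)) * ∫ θ in (0 : ℝ)..(2 * Real.pi),
      (γ * (s - c 2) + axialVelocity V (axisPt s t θ)) * ⟪V (axisPt s t θ), rotZ θ (EuclideanSpace.single (0 : Fin 3) (1 : ℝ))⟫ =
      endTermC γ c V T₀ s := by
    intro s
    rw [endTermC]
    refine intervalIntegral.integral_congr_ae (ae_of_all _ fun t ht => ?_)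
    rw [uIoc_of_le hT₀] at ht
    exact (circleAvg_endFlux_eq_slice γ c V s ht.1).symm
  have hoff : ∀ s : ℝ, γ * ∫ t in (0 : ℝ)..T₀, (1 / (2 * Real.pi)) * ∫ θ in (0 : ℝ)..(2 * Real.pi),
      (-⟪c, rotZ θ (EuclideanSpace.single (0 : Fin 3) (1 : ℝ))⟫) * axialVelocity V (axisPt s t θ) =
      offsetTerm γ c V T₀ s := by
    intro s
    rw [offsetTerm]
    congr 1
    refine intervalIntegral.integral_congr_ae (ae_of_all _ fun t ht => ?_)
    rw [uIoc_of_le hT₀] at ht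
    exact (circleAvg_offsetFlux_eq_slice c V s ht.1).symm
  rw [h, hend s₂, hend s₁, hoff s₂, hoff s₁]

/-- The end density of `axisLaw_slice` is continuous in the height (hence interval-integrable). [folklore] -/
theorem continuous_axisEndDensity (hV : ContDiff ℝ 1 V) (γ : ℝ) (c : EuclideanSpace ℝ (Fin 3)) (T₀ : ℝ) :
    Continuous fun σ : ℝ => ∫ t in (0 : ℝ)..T₀,
        ((1 / (2 * Real.pi)) * (∫ θ in (0 : ℝ)..(2 * Real.pi),
            ((γ + ⟪fderiv ℝ V (axisPt σ t θ) eZ, eZ⟫) *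
                ⟪V (axisPt σ t θ), rotZ θ (EuclideanSpace.single (0 : Fin 3) (1 : ℝ))⟫ +
              (γ * (σ - c 2) + axialVelocity V (axisPt σ t θ)) *
                ⟪fderiv ℝ V (axisPt σ t θ) eZ, rotZ θ (EuclideanSpace.single (0 : Fin 3) (1 : ℝ))⟫))
          - γ * ((1 / (2 * Real.pi)) * ∫ θ in (0 : ℝ)..(2 * Real.pi),
            (-⟪c, rotZ θ (EuclideanSpace.single (0 : Fin 3) (1 : ℝ))⟫) * ⟪fderiv ℝ V (axisPt σ t θ) eZ, eZ⟫)) := by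
  have hVc : Continuous V := hV.continuous
  have hA : Continuous fun p : ℝ × ℝ × ℝ =>
      ⟪V (axisPt p.1 p.2.1 p.2.2), rotZ p.2.2 (EuclideanSpace.single (0 : Fin 3) (1 : ℝ))⟫ := continuous_sliceA hVc
  have hC : Continuous fun p : ℝ × ℝ × ℝ => axialVelocity V (axisPt p.1 p.2.1 p.2.2) := continuous_sliceC hVc
  have hAZZ : Continuous fun p : ℝ × ℝ × ℝ => ⟪fderiv ℝ V (axisPt p.1 p.2.1 p.2.2) eZ, eZ⟫ :=
    continuous_sliceEntry hV continuous_const continuous_const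
  have hAZR : Continuous fun p : ℝ × ℝ × ℝ =>
      ⟪fderiv ℝ V (axisPt p.1 p.2.1 p.2.2) eZ, rotZ p.2.2 (EuclideanSpace.single (0 : Fin 3) (1 : ℝ))⟫ :=
    continuous_sliceEntry hV continuous_const continuous_rotZ_single_zero
  have hCR : Continuous fun p : ℝ × ℝ × ℝ => -⟪c, rotZ p.2.2 (EuclideanSpace.single (0 : Fin 3) (1 : ℝ))⟫ :=
    ((continuous_inner_rotZ_single_zero c).comp (continuous_snd.comp continuous_snd)).neg
  have hσ : Continuous fun p : ℝ × ℝ × ℝ => γ * (p.1 - c 2) := continuous_const.mul (continuous_fst.sub continuous_const)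
  have hX : Continuous fun p : ℝ × ℝ × ℝ => (γ + ⟪fderiv ℝ V (axisPt p.1 p.2.1 p.2.2) eZ, eZ⟫) *
        ⟪V (axisPt p.1 p.2.1 p.2.2), rotZ p.2.2 (EuclideanSpace.single (0 : Fin 3) (1 : ℝ))⟫ +
      (γ * (p.1 - c 2) + axialVelocity V (axisPt p.1 p.2.1 p.2.2)) *
        ⟪fderiv ℝ V (axisPt p.1 p.2.1 p.2.2) eZ, rotZ p.2.2 (EuclideanSpace.single (0 : Fin 3) (1 : ℝ))⟫ :=
    ((continuous_const.add hAZZ).mul hA).add ((hσ.add hC).mul hAZR)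
  have hY : Continuous fun p : ℝ × ℝ × ℝ => (-⟪c, rotZ p.2.2 (EuclideanSpace.single (0 : Fin 3) (1 : ℝ))⟫) *
      ⟪fderiv ℝ V (axisPt p.1 p.2.1 p.2.2) eZ, eZ⟫ := hCR.mul hAZZ
  have jc : ∀ {F : ℝ × ℝ × ℝ → ℝ}, Continuous F →
      Continuous (uncurry fun σ t : ℝ => (1 / (2 * Real.pi)) * ∫ θ in (0 : ℝ)..(2 * Real.pi), F (σ, t, θ)) :=
    fun hF => continuous_const.mul
      (intervalIntegral.continuous_parametric_intervalIntegral_of_continuous' (continuous_uncurry_pair hF) _ _)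
  have hF' : Continuous (uncurry fun σ t : ℝ =>
      ((1 / (2 * Real.pi)) * (∫ θ in (0 : ℝ)..(2 * Real.pi),
            ((γ + ⟪fderiv ℝ V (axisPt σ t θ) eZ, eZ⟫) *
                ⟪V (axisPt σ t θ), rotZ θ (EuclideanSpace.single (0 : Fin 3) (1 : ℝ))⟫ +
              (γ * (σ - c 2) + axialVelocity V (axisPt σ t θ)) *
                ⟪fderiv ℝ V (axisPt σ t θ) eZ, rotZ θ (EuclideanSpace.single (0 : Fin 3) (1 : ℝ))⟫))
          - γ * ((1 / (2 * Real.pi)) * ∫ θ in (0 : ℝ)..(2 * Real.pi),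
            (-⟪c, rotZ θ (EuclideanSpace.single (0 : Fin 3) (1 : ℝ))⟫) * ⟪fderiv ℝ V (axisPt σ t θ) eZ, eZ⟫))) :=
    (jc hX).sub (continuous_const.mul (jc hY))
  exact intervalIntegral.continuous_parametric_intervalIntegral_of_continuous' hF' _ _

/-- **THE GENERAL-LINE AXIS LAW, integrated form** (`HoopCore.AxisLawCentre γ` of `…HoopDefs`, HOOP-NOTE §8): for every
`IsSelfSimilarEulerProfile γ c V P` with ARBITRARY centre `c`, `s₁ ≤ s₂`, `T₀ > 0`, the identity (AX∫) holds VERBATIM with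
`endTermC` and the extra exact end term `−[offsetTerm]`.  Proof: LEAD 19832's fixed-height law `axisLaw_slice` integrated over
`[s₁, s₂]` (`integral_axisLaw_of_fixed`) and `integral_axisEndDensity_eq`.  A class-free identity about hypothetical profiles;
19832 OPEN; not NS. [HOOP-NOTE §2/§8 (ns-idea-11 g8); folklore] -/
theorem axisLawCentre (γ : ℝ) : AxisLawCentre γ := by
  intro c V P hprof s₁ s₂ T₀ hs hT₀
  have hV1 : ContDiff ℝ 1 V := hprof.contDiff_velocity.of_le (by norm_num)
  rw [integral_axisLaw_of_fixed hV1 γ hs hT₀ (fun σ _ => axisLaw_slice hprof σ hT₀)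
    ((continuous_axisEndDensity hV1 γ c T₀).intervalIntegrable _ _),
    integral_axisEndDensity_eq hV1 γ c s₁ s₂ hT₀.le]
  ring

/-- **THE AXIS LAW, integrated form about a RADIAL axis** (`HoopCore.AxisLawIntegrated γ` of `…HoopDefs`, HOOP-NOTE §2 (AX∫)): the
centre-`0` case of `axisLawCentre` (`endTermC γ 0 V = endTerm γ V`, `offsetTerm γ 0 V T₀ σ = 0`, ns-ezl-w3 g7's `…HoopAxisEndTerm`).
A class-free identity about hypothetical profiles; 19832 OPEN; not NS. [HOOP-NOTE §2 (ns-idea-11 g8); folklore] -/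
theorem axisLawIntegrated (γ : ℝ) : AxisLawIntegrated γ := by
  intro V P hprof s₁ s₂ T₀ hs hT₀
  have h := axisLawCentre γ 0 V P hprof s₁ s₂ T₀ hs hT₀
  rw [endTermC_zero, offsetTerm_zero, offsetTerm_zero, sub_zero, sub_zero] at h
  exact h

/-! ## Glue to the hoop inequality: the hoop term of the axis law is the hoop functional -/

/-- **The hoop term of (AX∫) IS the hoop functional of `hoopInequality`** (`V ∈ C¹`, `s₁ ≤ s₂`, `T₀ > 0`):
`∫_{s₁}^{s₂} ∫₀^{T₀} ⟨V_r² − V_θ²⟩(σ,t) dt/t dσ = (2π)⁻¹ ∫_{solidCyl s₁ s₂ T₀} hoopDensity V`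
(`axisHoopTerm_eq_sliceLHS` + `setIntegral_hoopDensity_eq_sliceChart`).  This is the bridge between the two tools of the hoop line:
substituting `hoopInequality` into `axisLawCentre` prices the integrated axis-minus-circle pressure drop of a straight run by the
Frobenius energy of its cylinder plus atom/end/lateral terms (HOOP-NOTE §4 CONSEQUENCE; the member T-J′ is the LEAD's to wire).
[folklore] -/
theorem integral_axisHoopTerm_eq_hoopDensity (hV : ContDiff ℝ 1 V) {s₁ s₂ T₀ : ℝ} (hs : s₁ ≤ s₂) (hT₀ : 0 < T₀) :
    ∫ σ in s₁..s₂, ∫ t in (0 : ℝ)..T₀,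
        circleAvg (fun y => radialVelocity V y ^ 2 - swirlVelocity V y ^ 2) σ t / t =
      1 / (2 * Real.pi) * ∫ y in solidCyl s₁ s₂ T₀, hoopDensity V y := by
  rw [setIntegral_hoopDensity_eq_sliceChart hV hs hT₀, ← intervalIntegral.integral_const_mul]
  exact intervalIntegral.integral_congr fun σ _ => axisHoopTerm_eq_sliceLHS V σ hT₀.le

end Summit.NavierStokesRegularity.NavierStokesRegularity.Theorems.PowerGaugeEulerLiouville.HoopCore

end
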